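import Literature.Algebra.Polynomial.CasasAlvero.InductionConverse
import Literature.Algebra.Polynomial.CasasAlvero.PrimePowSuccCounterexample
import Literature.Algebra.Polynomial.CasasAlvero.Degree5CharP
import Literature.Algebra.Polynomial.CasasAlvero.Degree5CharPLarge
import Literature.Algebra.Polynomial.CasasAlvero.Degree6CharP
import Literature.Algebra.Polynomial.CasasAlvero.Degree7CharP
import Literature.Algebra.Polynomial.CasasAlvero.FieldCorollaries
import Mathlib.Tactic.IntervalCases
import Mathlib.Tactic.NormNum.Prime
import HarnessLib

/-!
# Casas-Alvero in characteristic `p`: infinite families of good and bad degrees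

Packaging of the directory's results along the multiplicative induction `CA_n ⟸ CA_{n·p^k}`
(`holdsInDegree_of_mul_prime_pow`, any field of characteristic `p`) [GrafVonBothmerEtAl2007, Prop. 6]:

* (`holdsInDegree_prime_pow_field`, Descent) `CA_{p^k}(K)` for every field `K` of characteristic `p`;
* `¬ CA_{(p^k+1)·p^j}(K)` (`k ≥ 1`), `¬ CA_{5·p^j}` / `¬ CA_{6·p^j}` / `¬ CA_{7·p^j}` at every prime where this directory
  refutes `CA_5` / `CA_6` / `CA_7` by an explicit prime-field example;
* hence in every positive characteristic there are infinitely many degrees where the Casas-Alvero property holds and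
  infinitely many where it fails (`exists_gt_holdsInDegree`, `exists_gt_not_holdsInDegree`);
* the degree-7 refutation restated with the hypothesis `p ≤ 61, p ≠ 7`.
-/

noncomputable section

open Polynomial

namespace Literature.Algebra.Polynomial.CasasAlvero

variable (K : Type*) [Field K] (p : ℕ) [Fact p.Prime] [CharP K p]

/-- the infinite bad family `d = (p^k + 1)·p^j`, `k ≥ 1`. [cite: GrafVonBothmerEtAl2007, Prop. 6 and Example] -/
theorem not_holdsInDegree_prime_pow_succ_mul_prime_pow {k : ℕ} (hk : k ≠ 0) (j : ℕ) :
    ¬ HoldsInDegree K ((p ^ k + 1) * p ^ j) :=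
  not_holdsInDegree_mul_prime_pow p j (not_holdsInDegree_prime_pow_succ K p hk)

omit [Fact p.Prime] in
/-- `¬ CA_{5·p^j}` in characteristics `2, 3, 7, 11, 131, 193, 599, 8009`. [cite: CastryckLaterveerOunaies2012, §2] -/
theorem not_holdsInDegree_five_mul_prime_pow
    (hp : p = 2 ∨ p = 3 ∨ p = 7 ∨ p = 11 ∨ p = 131 ∨ p = 193 ∨ p = 599 ∨ p = 8009) (j : ℕ) :
    ¬ HoldsInDegree K (5 * p ^ j) := by
  have h5 : ¬ HoldsInDegree K 5 := by
    rcases hp with rfl | rfl | rfl | rfl | hl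
    · exact not_holdsInDegree_five_of_char_two K
    · exact not_holdsInDegree_five_of_char_three K
    · exact not_holdsInDegree_five_of_char_seven K
    · exact not_holdsInDegree_five_of_char_eleven K
    · exact not_holdsInDegree_five_of_charP_large K p hl
  have hprime : p.Prime := by
    rcases hp with rfl | rfl | rfl | rfl | rfl | rfl | rfl | rfl <;> norm_num
  haveI : Fact p.Prime := ⟨hprime⟩
  exact not_holdsInDegree_mul_prime_pow p j h5

omit [Fact p.Prime] in
/-- `¬ CA_{6·p^j}` in characteristics `2, 5, 7, 11, 13, 19, 23, 29, 37, 47`. [cite: CastryckLaterveerOunaies2012, §2] -/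
theorem not_holdsInDegree_six_mul_prime_pow
    (hp : p = 2 ∨ p = 5 ∨ p = 7 ∨ p = 11 ∨ p = 13 ∨ p = 19 ∨ p = 23 ∨ p = 29 ∨ p = 37 ∨ p = 47) (j : ℕ) :
    ¬ HoldsInDegree K (6 * p ^ j) := by
  have hprime : p.Prime := by
    rcases hp with rfl | rfl | rfl | rfl | rfl | rfl | rfl | rfl | rfl | rfl <;> norm_num
  haveI : Fact p.Prime := ⟨hprime⟩
  have h6 : ¬ HoldsInDegree K 6 := by
    rcases hp with rfl | rfl | hr
    · simpa using not_holdsInDegree_three_mul_two_pow (K := K) 1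
    · simpa using not_holdsInDegree_prime_succ K 5
    · exact not_holdsInDegree_six_of_charP K p hr
  exact not_holdsInDegree_mul_prime_pow p j h6

/-- `¬ CA_7` in every characteristic `p ≤ 61` other than `7` (hypothesis form of `not_holdsInDegree_seven_of_charP`).
[cite: CastryckLaterveerOunaies2012, §2] -/
theorem not_holdsInDegree_seven_of_le (h61 : p ≤ 61) (h7 : p ≠ 7) : ¬ HoldsInDegree K 7 := by
  have hprime : p.Prime := Fact.out
  refine not_holdsInDegree_seven_of_charP K p ?_
  interval_cases p <;> first | decide | exact absurd rfl h7 | (exfalso; revert hprime; decide)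

/-- `¬ CA_{7·p^j}` in every characteristic `p ≤ 61`, `p ≠ 7`. [cite: CastryckLaterveerOunaies2012, §2] -/
theorem not_holdsInDegree_seven_mul_prime_pow (h61 : p ≤ 61) (h7 : p ≠ 7) (j : ℕ) :
    ¬ HoldsInDegree K (7 * p ^ j) :=
  not_holdsInDegree_mul_prime_pow p j (not_holdsInDegree_seven_of_le K p h61 h7)

include p in
/-- in every positive characteristic the Casas-Alvero property HOLDS in infinitely many degrees … [cite: GrafVonBothmerEtAl2007, Prop. 2] -/
theorem exists_gt_holdsInDegree (N : ℕ) : ∃ d, N < d ∧ HoldsInDegree K d :=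
  ⟨p ^ N, Nat.lt_pow_self (Fact.out : p.Prime).one_lt, holdsInDegree_prime_pow_field K p N⟩

include p in
/-- … and FAILS in infinitely many degrees. [cite: GrafVonBothmerEtAl2007, Prop. 6] -/
theorem exists_gt_not_holdsInDegree (N : ℕ) : ∃ d, N < d ∧ ¬ HoldsInDegree K d := by
  refine ⟨(p ^ 1 + 1) * p ^ N, ?_, not_holdsInDegree_prime_pow_succ_mul_prime_pow K p one_ne_zero N⟩
  calc N < p ^ N := Nat.lt_pow_self (Fact.out : p.Prime).one_lt
    _ ≤ (p ^ 1 + 1) * p ^ N := Nat.le_mul_of_pos_left _ (by positivity)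

end Literature.Algebra.Polynomial.CasasAlvero
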